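import Literature.NumberTheory.GaloisRepresentations.FrobeniusPairZeta
import Literature.NumberTheory.GaloisRepresentations.SuperellipticFrobeniusFixedPlaces
import Literature.NumberTheory.LFunctions.FrobeniusCharpolyOfDet
import HarnessLib

/-!
# `#Pic⁰(C_Ω)^{φ^r} = ∏ᵢ (1 - αᵢ^r)` for the superelliptic curves `y^p = f(x)` over a finite field

Topic `Literature/NumberTheory/GaloisRepresentations`; **proof file** (theorems only; D-0014/D-0026: no
definitions, no named facts).  Let `k = 𝔽_q`, `Ω ⊇ k` algebraically closed and algebraic, `p` prime with
`p ≠ 0` in `k`, `f ∈ k[X]` separable with `p ∤ deg f`, `C_f : y^p = f(x)`, `φ ∈ Gal(Ω/k)` the `q`-Frobenius acting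
on `Ω(C_f) = Ω(x)[y]/(y^p - f)` through the coefficients, hence on places, divisors and the divisor class group
`Pic(C_{f,Ω}) = Cl(Ω(C_f)/Ω)` (`SuperellipticPic`).

**Main theorem** (`exists_natCard_fixed_degreeZero_eq_prod`).  There are complex numbers `α₁, …, α_{2g}`,
`g = genus k(C_f)`, with `|αᵢ| = √q` and `N_m(k(C_f)) = q^m + 1 - ∑ᵢ αᵢ^m` for all `m ≥ 1` (the reciprocal roots
of the `L`-polynomial; Hasse–Weil, proved in the tree), such that for every `r ≥ 1`

  `#{c ∈ Pic(C_{f,Ω}) : deg c = 0, φ^r c = c} = ∏ᵢ (1 - αᵢ^r)`.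

This is the identity "`#J(𝔽_{q^r}) = h(k(C_f)𝔽_{q^r}) = L_r(1) = ∏ (1 - ωᵢ^r)`" of Milne's proof of *Jacobian
varieties* Thm. 11.1 — the divisor-theoretic half of Weil's determination of the characteristic polynomial of
Frobenius on `T_ℓ J` — proved WITHOUT the Jacobian and without the Galois descent `J(𝔽_{q^r}) ≅ Pic⁰(C_{𝔽_{q^r}})`:
the zeta function of the pair `(Ω(C_f), σ = φ^r)` (`FrobeniusInvariantDivisors`, `FrobeniusPairZetaEulerProduct`,
`FrobeniusPairZeta`: invariant positive divisors counted in invariant classes by Lang's theorem for `GL_m` on the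
Riemann–Roch spaces and by Riemann–Roch over `Ω`; Euler product over the `σ`-orbits of places) has
`L^σ(1) = h^σ` and `N_s^σ = #Fix(φ^{rs}) = N_{rs}(k(C_f))` (`natCard_fixedPlaces_frobenius_pow_eq_pointCount`);
comparing logarithmic derivatives over `ℂ` (`LPolynomial.cast_coeff_eq_of_logDeriv`) the reciprocal roots of `L^σ`
have the power sums of the `αᵢ^r`, so they ARE the `αᵢ^r` (`FrobeniusCharpoly.univ_val_map_eq_of_forall_sum_pow_eq`),
and `h^σ = L^σ(1) = ∏ᵢ (1 - αᵢ^r)`.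

Also: every place of `Ω(C_f)` is `φ`-periodic (`exists_pow_smul_eq_self`) and `#Fix(φ^s) < ∞`
(`finite_fixedPlaces_frobenius_pow`).  The remaining, genuinely geometric, half of Weil's theorem —
`det(1 - V_ℓ(φ)^r) = #Pic⁰(C_Ω)^{φ^r}` ("`deg = det`") — is the hypothesis of the door
`picardCurve_exists_lambdaAdicRep_of_degdet` (`PicardFrobeniusDegDet`).

## References
* J. S. Milne, *Jacobian varieties* (§11, Thm. 11.1 and its proof) and *Abelian varieties* (Thm. 19.1), in:
  Arithmetic Geometry (Cornell–Silverman eds.), Springer (1986). [Milne1986JacobianVarieties] [Milne1986AbelianVarieties]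
* H. Stichtenoth, *Algebraic Function Fields and Codes*, 2nd ed. (2009), Thm. 5.1.15, Cor. 5.1.16, Thm. 5.2.1.
  [Stichtenoth2009]
* A. Weil, *Sur les courbes algébriques et les variétés qui s'en déduisent* (1948), §IV. [Weil1948]
* M. Rosen, *Number Theory in Function Fields* (2002), Ch. 8 (constant field extensions) and Ch. 11, p. 199. [RosenFunctionFields2002]
-/

noncomputable section

open Polynomial
open scoped Classical

namespace Literature.NumberTheory.GaloisRepresentations

open Literature.NumberTheory.DiophantineGeometry Literature.NumberTheory.DiophantineGeometry.AlgFunctionField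
  Literature.NumberTheory.LFunctions SuperellipticFunctionField

universe u v

attribute [local instance] Finsupp.comapSMul Finsupp.comapMulAction Finsupp.comapDistribMulAction
attribute [local instance] divisorClassDistribMulAction

namespace SuperellipticFunctionField

variable {k : Type u} [Field k] [Fintype k] {Ω : Type v} [Field Ω] [Algebra k Ω] [IsAlgClosed Ω]
variable {p : ℕ} [hp : Fact p.Prime] {f : k[X]} [Fact (Irreducible (superellipticPoly k Ω p f))]

/-! ### Every place of `Ω(C_f)` is Frobenius-periodic (`Ω` algebraic over `k`) -/

omit hp [Fact (Irreducible (superellipticPoly k Ω p f))] [IsAlgClosed Ω] in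
/-- An element of `Ω`, algebraic over `k = 𝔽_q`, is fixed by a positive power of the `q`-Frobenius (it lies in
the finite field `k(a)`, of cardinality `q^d`, `d = [k(a) : k]`). [folklore] -/
theorem exists_pow_apply_eq_self [Algebra.IsAlgebraic k Ω] (φ : Ω ≃ₐ[k] Ω)
    (hφ : ∀ x : Ω, φ x = x ^ Fintype.card k) (a : Ω) : ∃ d, 0 < d ∧ (φ ^ d) a = a := by
  set E : IntermediateField k Ω := IntermediateField.adjoin k {a} with hE
  haveI : FiniteDimensional k E :=
    IntermediateField.adjoin.finiteDimensional (Algebra.IsIntegral.isIntegral (R := k) a)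
  haveI : Finite E := Module.finite_of_finite k
  letI : Fintype E := Fintype.ofFinite _
  refine ⟨Module.finrank k E, Module.finrank_pos, ?_⟩
  rw [algEquiv_pow_apply_eq_pow_card_pow φ hφ, ← Nat.card_eq_fintype_card,
    ← Module.natCard_eq_pow_finrank (K := k) (V := E), Nat.card_eq_fintype_card]
  have h := FiniteField.pow_card (⟨a, IntermediateField.mem_adjoin_simple_self k a⟩ : E)
  exact congrArg Subtype.val h

omit hp [Fact (Irreducible (superellipticPoly k Ω p f))] [IsAlgClosed Ω] [Fintype k] in
/-- If `φ^d a = a` then `φ^{d m} a = a`. [folklore] -/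
theorem pow_mul_apply_eq_self (φ : Ω ≃ₐ[k] Ω) {d : ℕ} {a : Ω} (h : (φ ^ d) a = a) (m : ℕ) :
    (φ ^ (d * m)) a = a := by
  induction m with
  | zero => simp
  | succ m ih => rw [Nat.mul_succ, pow_add, AlgEquiv.mul_apply, h, ih]

omit hp [Fact (Irreducible (superellipticPoly k Ω p f))] [IsAlgClosed Ω] [Fintype k] [Field k] [Field Ω] [Algebra k Ω] in
/-- If `g • a = a` then `g^n • a = a`. [folklore] -/
theorem pow_smul_eq_of_smul_eq {M : Type*} {β : Type*} [Monoid M] [MulAction M β] {g : M} {a : β}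
    (h : g • a = a) (n : ℕ) : g ^ n • a = a := by
  induction n with
  | zero => rw [pow_zero, one_smul]
  | succ n ih => rw [pow_succ, mul_smul, h, ih]

/-- **Every place of `Ω(C_f)/Ω` is fixed by a positive power of Frobenius** (`Ω ⊇ k` algebraically closed and
algebraic: a place is `∞_C` or the place of a point with coordinates in some `𝔽_{q^d}`). [folklore] -/
theorem exists_pow_smul_eq_self [Algebra.IsAlgebraic k Ω] (φ : Ω ≃ₐ[k] Ω) (hφ : ∀ x : Ω, φ x = x ^ Fintype.card k)
    (hpk : (p : k) ≠ 0) (hsep : f.Separable) (hndvd : ¬ p ∣ f.natDegree)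
    (P : PlaceOver Ω (SuperellipticFunctionField k Ω p f)) : ∃ s, 0 < s ∧ (φ ^ s) • P = P := by
  haveI : NeZero ((p : ℕ) : Ω) := ⟨by rwa [Ne, ← map_natCast (algebraMap k Ω), map_eq_zero]⟩
  obtain ⟨ζ₀, hζ₀⟩ := HasEnoughRootsOfUnity.exists_primitiveRoot Ω p
  rcases eq_inftyPlace_or_exists_eq_pointPlace hζ₀ hsep hndvd P with rfl | ⟨a, b, hb, rfl⟩
  · exact ⟨1, Nat.one_pos, smul_inftyPlace hndvd _⟩
  · obtain ⟨da, hda, ha⟩ := exists_pow_apply_eq_self φ hφ a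
    obtain ⟨db, hdb, hb'⟩ := exists_pow_apply_eq_self φ hφ b
    refine ⟨da * db, Nat.mul_pos hda hdb, ?_⟩
    rw [smul_pointPlace hζ₀ hsep _ hb, AlgEquiv.smul_def, AlgEquiv.smul_def, pow_mul_apply_eq_self φ ha,
      mul_comm da db, pow_mul_apply_eq_self φ hb']

/-- **The places fixed by `φ^s` (`s ≥ 1`) form a finite set** (`natCard_fixedPlaces_frobenius_pow`). [folklore] -/
theorem finite_fixedPlaces_frobenius_pow [Algebra.IsAlgebraic k Ω] (φ : Ω ≃ₐ[k] Ω)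
    (hφ : ∀ x : Ω, φ x = x ^ Fintype.card k) (hpk : (p : k) ≠ 0) (hsep : f.Separable) (hndvd : ¬ p ∣ f.natDegree)
    {s : ℕ} (hs : 0 < s) : Finite {P : PlaceOver Ω (SuperellipticFunctionField k Ω p f) // (φ ^ s) • P = P} := by
  obtain ⟨ψ, -, hirr, -, hψdeg⟩ := exists_irreducible_natDegree_eq k hs
  haveI : Fact (Irreducible ψ) := ⟨hirr⟩
  letI : Fintype (AdjoinRoot ψ) := Fintype.ofFinite _
  letI : Algebra (AdjoinRoot ψ) Ω := (IsAlgClosed.lift : AdjoinRoot ψ →ₐ[k] Ω).toRingHom.toAlgebra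
  haveI : IsScalarTower k (AdjoinRoot ψ) Ω :=
    IsScalarTower.of_algebraMap_eq fun x => ((IsAlgClosed.lift : AdjoinRoot ψ →ₐ[k] Ω).commutes x).symm
  have hcardK' : Fintype.card (AdjoinRoot ψ) = Fintype.card k ^ s := by
    rw [← Nat.card_eq_fintype_card, natCard_adjoinRoot, Nat.card_eq_fintype_card, hψdeg]
  apply Nat.finite_of_card_ne_zero
  rw [natCard_fixedPlaces_frobenius_pow φ hφ hpk hsep hndvd hcardK']
  exact Nat.succ_ne_zero _

/-! ### The class number of `σ = φ^r`-invariant classes: `h^{φ^r} = ∏ᵢ (1 - αᵢ^r)` -/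

/-- **`#Pic⁰(C_f)(𝔽_{q^r}) = ∏ᵢ (1 - αᵢ^r)`** for `C_f : y^p = f(x)` over `k = 𝔽_q` (`p ≠ 0` in `k`, `f` separable,
`p ∤ deg f`), `Ω ⊇ k` algebraically closed and algebraic, `φ ∈ Gal(Ω/k)` the `q`-Frobenius: there are complex
numbers `α₁, …, α_{2g}` of absolute value `√q` (the reciprocal roots of the `L`-polynomial of `k(C_f)`:
`N_m(k(C_f)) = q^m + 1 - ∑ αᵢ^m` for all `m ≥ 1`, Hasse–Weil, PROVED in the tree) such that for every `r ≥ 1` the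
number of degree-zero divisor classes of `Ω(C_f)` fixed by `φ^r` is `∏ᵢ (1 - αᵢ^r)`.

Proof (Milne, *Jacobian varieties*, proof of Thm. 11.1, "`#J(𝔽_{q^r}) = h_r = ∏ (1 - ωᵢ^r)`", with the descent
`J(𝔽_{q^r}) = Pic⁰(C)(𝔽_{q^r}) = Pic⁰(C_Ω)^{φ^r}` replaced by a direct count): the zeta function of the pair
`(Ω(C_f), σ = φ^r)` (`FrobeniusPairZeta`: `σ`-invariant positive divisors, counted through Lang's theorem on the
Riemann–Roch spaces and Riemann–Roch over `Ω`) has `L^σ(1) = h^σ` and Euler factorisation over the `σ`-orbits with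
`N_s^σ = #Fix(φ^{rs}) = N_{rs}(k(C_f))` (`natCard_fixedPlaces_frobenius_pow_eq_pointCount`); comparing logarithmic
derivatives over `ℂ` (`LPolynomial.cast_coeff_eq_of_logDeriv`) the reciprocal roots of `L^σ` have the same power
sums as the `αᵢ^r`, hence coincide with them (`FrobeniusCharpoly.univ_val_map_eq_of_forall_sum_pow_eq`), and
`h^σ = L^σ(1) = ∏ᵢ (1 - αᵢ^r)`.
[cite: Milne1986JacobianVarieties, §11 Thm. 11.1 (proof)] [cite: Stichtenoth2009, Thm. 5.1.15, Thm. 5.2.1]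
[cite: Weil1948, §IV] -/
theorem exists_natCard_fixed_degreeZero_eq_prod [Algebra.IsAlgebraic k Ω] (φ : Ω ≃ₐ[k] Ω)
    (hφ : ∀ x : Ω, φ x = x ^ Fintype.card k) (hpk : (p : k) ≠ 0) (hsep : f.Separable) (hndvd : ¬ p ∣ f.natDegree)
    [Fact (Irreducible (superellipticPoly k k p f))] :
    ∃ α : Fin (2 * genus k (SuperellipticFunctionField k k p f)) → ℂ,
      (∀ i, ‖α i‖ = √(Fintype.card k : ℝ)) ∧
      (∀ m : ℕ, 0 < m → (pointCount k (SuperellipticFunctionField k k p f) m : ℂ) =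
        (Fintype.card k : ℂ) ^ m + 1 - ∑ i, α i ^ m) ∧
      ∀ r : ℕ, 0 < r →
        (Nat.card {c : SuperellipticPic k Ω p f // SuperellipticPic.degree k Ω p f c = 0 ∧ (φ ^ r) • c = c} : ℂ) =
          ∏ i, (1 - α i ^ r) := by
  -- the curve over `k`: reciprocal roots `αᵢ` of its `L`-polynomial (Hasse–Weil, proved in the tree)
  haveI : IsIntegrallyClosedIn k (SuperellipticFunctionField k k p f) :=
    isIntegrallyClosedIn_of_isRational (degree_inftyPlace hndvd)
  obtain ⟨α, hαn, hαN⟩ := exists_pointCount_eq_of_facts (K := k) (F := SuperellipticFunctionField k k p f)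
    lSeries_eq_polynomial_holds hasseWeil_holds
  have hq1 : (1 : ℝ) < Fintype.card k := by exact_mod_cast Fintype.one_lt_card
  have hα0 : ∀ i, α i ≠ 0 := fun i h => by
    have := hαn i
    rw [h, norm_zero] at this
    exact (Real.sqrt_pos.2 (by linarith)).ne this
  refine ⟨α, hαn, hαN, fun r hr => ?_⟩
  -- the pair `(Ω(C_f), σ = φ^r)` and the level field `k' = 𝔽_{q^r}`
  set F := SuperellipticFunctionField k Ω p f with hF
  set σ : Ω ≃ₐ[k] Ω := φ ^ r with hσdef
  obtain ⟨ψ, -, hirr, -, hψdeg⟩ := exists_irreducible_natDegree_eq k hr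
  haveI : Fact (Irreducible ψ) := ⟨hirr⟩
  letI : Fintype (AdjoinRoot ψ) := Fintype.ofFinite _
  letI : Algebra (AdjoinRoot ψ) Ω := (IsAlgClosed.lift : AdjoinRoot ψ →ₐ[k] Ω).toRingHom.toAlgebra
  have hcardK : Nat.card (AdjoinRoot ψ) = Fintype.card k ^ r := by
    rw [natCard_adjoinRoot, Nat.card_eq_fintype_card, hψdeg]
  have hσ : ∀ c : Ω, σ • algebraMap Ω F c = algebraMap Ω F (c ^ Nat.card (AdjoinRoot ψ)) := fun c => by
    rw [smul_algebraMap_superelliptic, AlgEquiv.smul_def, hσdef, algEquiv_pow_apply_eq_pow_card_pow φ hφ, hcardK]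
  have hper : ∀ P : PlaceOver Ω F, ∃ s, 0 < s ∧ (σ ^ s) • P = P := fun P => by
    obtain ⟨s, hs, h⟩ := exists_pow_smul_eq_self φ hφ hpk hsep hndvd P
    refine ⟨s, hs, ?_⟩
    rw [hσdef, ← pow_mul, mul_comm, pow_mul]
    exact pow_smul_eq_of_smul_eq h r
  have hfin : ∀ s, 0 < s → Finite {P : PlaceOver Ω F // (σ ^ s) • P = P} := fun s hs => by
    rw [hσdef, ← pow_mul]
    exact finite_fixedPlaces_frobenius_pow φ hφ hpk hsep hndvd (Nat.mul_pos hr hs)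
  have hP₀ : σ • inftyPlace k Ω p f = inftyPlace k Ω p f := smul_inftyPlace hndvd σ
  haveI : IsIntegrallyClosedIn Ω F := isIntegrallyClosedIn_of_isRational (degree_inftyPlace (K := k) (L := Ω) hndvd)
  -- the zeta function of the pair
  obtain ⟨L, -, hL, heval⟩ := exists_pairLPolynomial (k := AdjoinRoot ψ) hσ hper hfin hP₀
  have hderiv := X_mul_derivative_pairZeta (σ := σ) hper hfin
  set Z : PowerSeries ℤ := PowerSeries.mk fun n =>
    (Nat.card {A : Divisor Ω F // 0 ≤ A ∧ σ • A = A ∧ A.degree = n} : ℤ) with hZ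
  set N : PowerSeries ℤ := PowerSeries.mk fun s =>
    if s = 0 then 0 else (Nat.card {P : PlaceOver Ω F // (σ ^ s) • P = P} : ℤ) with hN
  have hZ0 : PowerSeries.constantCoeff Z = 1 := by
    rw [← PowerSeries.coeff_zero_eq_constantCoeff_apply, hZ, PowerSeries.coeff_mk]
    exact_mod_cast natCard_invariant_effective_degree_zero (Ω := Ω) (F := F) σ
  -- power sums of the reciprocal roots of `L^σ`
  have hpow : ∀ s, 0 < s →
      ((L.map (Int.castRingHom ℂ)).roots.map fun z => z⁻¹ ^ s).sum = ∑ i, (α i ^ r) ^ s := by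
    intro s hs
    have h1 := LPolynomial.cast_coeff_eq_of_logDeriv hZ0 hderiv (Nat.card (AdjoinRoot ψ) : ℤ) L hL hs
    have h2 : PowerSeries.coeff s N = (Nat.card {P : PlaceOver Ω F // (φ ^ (r * s)) • P = P} : ℤ) := by
      rw [hN, PowerSeries.coeff_mk, if_neg hs.ne', hσdef, ← pow_mul]
    rw [h2, natCard_fixedPlaces_frobenius_pow_eq_pointCount φ hφ hpk hsep hndvd (Nat.mul_pos hr hs), hcardK] at h1
    push_cast at h1
    rw [hαN (r * s) (Nat.mul_pos hr hs)] at h1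
    simp_rw [← pow_mul]
    linear_combination h1
  -- enumerate the reciprocal roots and identify them with the `αᵢ^r`
  set Lc : ℂ[X] := L.map (Int.castRingHom ℂ) with hLc
  have hL0 : L.coeff 0 = 1 := by
    have h := congrArg (PowerSeries.coeff 0) hL
    rw [Polynomial.coeff_coe] at h
    rw [h, PowerSeries.coeff_zero_eq_constantCoeff, map_mul, map_mul, hZ0]
    simp
  have hLc0 : Lc.coeff 0 = 1 := by rw [hLc, Polynomial.coeff_map, hL0, map_one]
  have hcard : Multiset.card Lc.roots = Lc.natDegree := Polynomial.splits_iff_card_roots.mp (IsAlgClosed.splits Lc)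
  obtain ⟨e, he⟩ := LPolynomial.exists_fin_enum Lc.roots hcard
  have he0 : ∀ j, e j ≠ 0 := fun j =>
    LPolynomial.ne_zero_of_mem_roots_of_coeff_zero_eq_one hLc0 (by rw [← he]; exact Multiset.mem_map_of_mem _ (Finset.mem_univ_val j))
  have hγα : (Finset.univ.val.map fun j => (e j)⁻¹) = Finset.univ.val.map fun i => α i ^ r := by
    refine FrobeniusCharpoly.univ_val_map_eq_of_forall_sum_pow_eq (fun j => inv_ne_zero (he0 j))
      (fun i => pow_ne_zero _ (hα0 i)) fun s hs => ?_
    rw [← hpow s hs, ← he, Multiset.map_map, Finset.sum_eq_multiset_sum]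
    rfl
  -- evaluate `L^σ` at `1`
  have hprod := LPolynomial.eq_prod_one_sub_inv_mul_X Lc hcard hLc0
  have hevalC : Lc.eval 1 = ((Finset.univ.val.map fun j => (e j)⁻¹).map fun γ => 1 - γ).prod := by
    conv_lhs => rw [hprod]
    rw [Polynomial.eval_multiset_prod, Multiset.map_map, ← he, Multiset.map_map, Multiset.map_map]
    refine congrArg _ (Multiset.map_congr rfl fun z _ => ?_)
    simp
  rw [hγα, Multiset.map_map] at hevalC
  have hevalC' : Lc.eval 1 = ∏ i, (1 - α i ^ r) := by
    rw [hevalC, Finset.prod_eq_multiset_prod]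
    rfl
  -- `h^σ` for `SuperellipticPic` is the `h^σ` of the pair
  have hh : Nat.card {c : SuperellipticPic k Ω p f // SuperellipticPic.degree k Ω p f c = 0 ∧ σ • c = c} =
      Nat.card {c : DivisorClass Ω F // DivisorClass.degree c = 0 ∧ σ • c = c} := rfl
  rw [hh, ← hevalC', hLc, Polynomial.eval_map, Polynomial.eval₂_at_one, heval]
  simp

end SuperellipticFunctionField

end Literature.NumberTheory.GaloisRepresentations
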